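import Summits.BirchSwinnertonDyer.BirchSwinnertonDyer.Theorems.PrintCFramBottomClassIndexLawFiveLeEisensteinAnalyticEndState
import Summits.BirchSwinnertonDyer.BirchSwinnertonDyer.Theorems.PrintCFramBottomClassIndexLawFiveLeEisensteinLineDataOfPrint
import Summits.BirchSwinnertonDyer.BirchSwinnertonDyer.Theorems.SchneiderFreeAdditiveX3AnticycControlAdditiveNoLocalPTorsionAtoms
import Summits.BirchSwinnertonDyer.BirchSwinnertonDyer.Theorems.UniversalToricDescentStrictPlaceNoPTorsion
import HarnessLib

/-!
# Route `PrintCFram`, crux C2 `BottomClassIndexLawFiveLe` (stmt-BirchSwinnertonDyer-20372), line `eisenstein-resource-bdp-line`, skeleton v4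
# (sha16 fefbf6bba78d6cf1): the REGISTERED stub (AN) `stub_analyticInequality_cmRamified` BY NAME ⟸ the PRINT stub (CGLS Prop. 14) ∧
# per-frame «congruence + character residual bounds» — all LINE DATA and (L) DISCHARGED on the CM-ramified class
# (cell `bsd-print-cfram`, width seat `bsd-line-cfram-p1-w2` g3; helper `--supports` 20372; ONE theorem, 0 facts, 0 definitions)

HONEST FRAMING. Nothing about BSD is proved; (AN) is NOT closed. This is the assembly of `…EisensteinAnalyticEndState` (w2 g3) with LEAD g4's
`lineData_cmRamified_of_prop14` (the residual line of the rational `p`-isogeny over the Heegner field and its clauses, modulo the one named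
fact `CastellaGrossiLeeSkinner2022.prop14_residualCharacterSelmer_finite` = registered `stub_residualCharacterSelmerFinite`), k7r's
`W(ℚ_p)[p] = 0` (`prime_nsmul_eq_zero_padic_of_hasCM_of_cmRamified`) and the X11b pro-`p` descent
(`SchneiderFreeAdditiveX3.fixedPoints_decomp_inf_kerSubgroup_eq_bot_of_noPTorsionPadic`) for (L) at the degree-one `𝔭'`:

  `stub_analyticInequality_cmRamified_of_prop14_of_congruenceBounds :
     prop14 → (∀ frame, ∀ Φ line at the frame (no fixed vector in the quotient, finite residual Selmer groups at the bad set),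
                 ∃ u L₁ L₂, IsUnit u ∧ Q ≡ u·L₁·L₂ (mod 𝔪) ∧ log_p(#R(Φ)·#R(W[p]/Φ)) ≤ ord L̄₁ + ord L̄₂)
            → stub_analyticInequality_cmRamified (verbatim)`.

So, modulo the print stub, the registered research stub (AN) IS «Λ-adic congruence (AN-cong) + character residual inequalities (AN-λ-res)».
BSD is not proved by any of this; no summit statement is proved by this seat.

References: Castella–Grossi–Lee–Skinner 2022 §3 Thm. 3.2.1, Props. 14, 17, 18 [CastellaGrossiLeeSkinner2022]; Greenberg–Vatsal 2000 Thm. (1.3),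
(17) [GreenbergVatsal2000]; Kriz–Li 2019 §7 [KrizLi2019]; Brink 2007 Thm. 2 [Brink2007]; Mazur 1977 III.5 [Mazur1977].
-/

set_option autoImplicit false
-- the summit namespace `Summit.BirchSwinnertonDyer.BirchSwinnertonDyer` repeats the problem name by design (D-0017)
set_option linter.dupNamespace false

noncomputable section

open scoped Classical

namespace Summit.BirchSwinnertonDyer.BirchSwinnertonDyer.Theorems.PrintCFram.LambdaResidualBound

open WeierstrassCurve NumberField IsDedekindDomain Field PowerSeries IsLocalRing
  Literature.NumberTheory.EllipticCurves Literature.NumberTheory.EllipticCurves.GreenbergSelmer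
  Literature.NumberTheory.EllipticCurves.GreenbergVatsal2000
  Literature.NumberTheory.EllipticCurves.ModularForms
  Literature.NumberTheory.EllipticCurves.Rank1Residual
  Literature.NumberTheory.EllipticCurves.Rank1Residual.Typed
  Literature.NumberTheory.EllipticCurves.IwasawaAlgebra
  Literature.NumberTheory.GaloisRepresentations
  Summit.BirchSwinnertonDyer.Rank1Residual
  Summit.BirchSwinnertonDyer.Rank1Residual.X11b Summit.BirchSwinnertonDyer.Rank1Residual.X11b.AcSelmer
  Summit.BirchSwinnertonDyer.Rank1Residual.X2.ResidualDevissageModules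
  Summit.BirchSwinnertonDyer.BirchSwinnertonDyer.Theorems
  Summit.BirchSwinnertonDyer.BirchSwinnertonDyer.Theorems.SchneiderFree
  Summit.BirchSwinnertonDyer.BirchSwinnertonDyer.Theorems.RamifiedSevenEllipticUnits
  Summit.BirchSwinnertonDyer.BirchSwinnertonDyer.Theorems.PrintCFram.EisensteinMatchAnatomy
  Summit.BirchSwinnertonDyer.BirchSwinnertonDyer.Theorems.PrintCFram.EisensteinResourceBdpLine
  Summit.BirchSwinnertonDyer.BirchSwinnertonDyer.Theorems.UniversalToricDescentStrictPlace

/-- **REGISTERED (AN) `stub_analyticInequality_cmRamified` (v4, verbatim) ⟸ CGLS Prop. 14 (the print stub) ∧ per-frame «congruence + character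
residual bounds» for EVERY residual line at the frame.** The second hypothesis asks, at every ♭-BDP frame and for every `Γ_K`-stable
`Φ ≤ W_K[p]` with no non-zero `ker κ ⊓ D_{𝔭'}`-fixed vector in `W_K[p]/Φ` and finite residual Selmer groups `R_{𝔭'}^S(K_∞, Φ)`, `R_{𝔭'}^S(K_∞, W_K[p]/Φ)`
at the bad set `S = {v : ¬ good, p ∉ v}`: a unit `u` and `L₁, L₂ ∈ 𝓞_{ℂ_p}⟦T⟧` with `Q ≡ u·L₁·L₂ (mod 𝔪)` coefficientwise (AN-cong) and
`log_p(#R(Φ)·#R(W_K[p]/Φ)) ≤ ord L̄₁ + ord L̄₂` (AN-λ-res). The line itself, its local clause, (L) `W_K[p^∞]^{ker κ ⊓ D_{𝔭'}} = 0` and Brink are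
theorems on the class. CONDITIONAL; closes nothing. [cite: CastellaGrossiLeeSkinner2022, §3 Thm. 3.2.1 and Props. 14, 17, 18 (arXiv:2008.02571)]
[cite: GreenbergVatsal2000, Thm. (1.3) and (17)] [cite: Mazur1977, Ch. III §5 Step 1 (p. 158)] -/
theorem stub_analyticInequality_cmRamified_of_prop14_of_congruenceBounds
    (hfact : CastellaGrossiLeeSkinner2022.prop14_residualCharacterSelmer_finite)
    (hcb : ∀ (p : ℕ) [Fact p.Prime] (W : WeierstrassCurve ℚ) [W.IsElliptic] [W.IsGloballyMinimal],
      W.HasCM → CMRamified W p → 5 ≤ p → W.analyticRank = 1 →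
      ∀ (N : ℕ) [NeZero N] (K : Type) [Field K] [NumberField K] (Dt : ModularParametrizationData W N),
      W.conductorNorm ℤ = N → IsImaginaryQuadratic K → SatisfiesHeegnerHypothesis N K →
      ∀ (κ : ZpExtension K p), κ.IsAnticyclotomic → ∀ (γ : Field.absoluteGaloisGroup K) [Fact (κ.IsTopGenerator γ)]
        (𝔭 : HeightOneSpectrum (𝓞 K)), ((p : ℕ) : 𝓞 K) ∈ 𝔭.asIdeal → 𝔭.asIdeal.ramificationIdx (𝓞 ℚ) = 1 →
        𝔭.asIdeal.inertiaDeg (𝓞 ℚ) = 1 → ∀ (𝔭' : HeightOneSpectrum (𝓞 K)), ((p : ℕ) : 𝓞 K) ∈ 𝔭'.asIdeal → 𝔭' ≠ 𝔭 →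
        ∀ (ι' : PadicAlgCl p ≃+* ℂ), SchneiderFree.BranchInducesPrime p ι' 𝔭 →
        ∀ (ΩK : ℂ) (Ωp : ℂ_[p]) (Q : PowerSeries (PadicComplexInt p)), ΩK ≠ 0 → Ωp ≠ 0 →
          R1.IsBDPLFunctionInt p ι' 𝔭 κ γ Dt.f ΩK Ωp Q →
          ∀ (Φ : X2.ResidualDevissageModules.StableSubgroup (absoluteGaloisGroup K) ((W.baseChange K).geomTorsion (p : ℤ))),
            (∀ y : Φ.Quot, (∀ g : ↥(κ.kerSubgroup ⊓ decomp 𝔭'), g • y = y) → y = 0) →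
            (datumStrictSelmer κ.kerSubgroup Φ.Sub p (AcSelmer.bdpData Φ.Sub p 𝔭')
                {v : HeightOneSpectrum (𝓞 K) | ¬ (W.baseChange K).HasGoodReductionAt v ∧ ((p : ℕ) : 𝓞 K) ∉ v.asIdeal} :
              Set (subgroupH1 κ.kerSubgroup Φ.Sub)).Finite →
            (datumStrictSelmer κ.kerSubgroup Φ.Quot p (AcSelmer.bdpData Φ.Quot p 𝔭')
                {v : HeightOneSpectrum (𝓞 K) | ¬ (W.baseChange K).HasGoodReductionAt v ∧ ((p : ℕ) : 𝓞 K) ∉ v.asIdeal} :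
              Set (subgroupH1 κ.kerSubgroup Φ.Quot)).Finite →
            ∃ u L₁ L₂ : PowerSeries (PadicComplexInt p), IsUnit u ∧
              (∀ n, PowerSeries.coeff n Q - PowerSeries.coeff n (u * L₁ * L₂) ∈ maximalIdeal (PadicComplexInt p)) ∧
              ((Nat.log p
                  (Nat.card (datumStrictSelmer κ.kerSubgroup Φ.Sub p (AcSelmer.bdpData Φ.Sub p 𝔭')
                      {v : HeightOneSpectrum (𝓞 K) | ¬ (W.baseChange K).HasGoodReductionAt v ∧ ((p : ℕ) : 𝓞 K) ∉ v.asIdeal}) *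
                    Nat.card (datumStrictSelmer κ.kerSubgroup Φ.Quot p (AcSelmer.bdpData Φ.Quot p 𝔭')
                      {v : HeightOneSpectrum (𝓞 K) | ¬ (W.baseChange K).HasGoodReductionAt v ∧ ((p : ℕ) : 𝓞 K) ∉ v.asIdeal}))
                  : ℕ) : ℕ∞) ≤
                (PowerSeries.map (residue (PadicComplexInt p)) L₁).order +
                  (PowerSeries.map (residue (PadicComplexInt p)) L₂).order) :
    ∀ (p : ℕ) [Fact p.Prime] (W : WeierstrassCurve ℚ) [W.IsElliptic] [W.IsGloballyMinimal],
      W.HasCM → CMRamified W p → 5 ≤ p → W.analyticRank = 1 →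
      ∀ (N : ℕ) [NeZero N] (K : Type) [Field K] [NumberField K] (Dt : ModularParametrizationData W N),
      W.conductorNorm ℤ = N → IsImaginaryQuadratic K → SatisfiesHeegnerHypothesis N K →
      ∀ (κ : ZpExtension K p), κ.IsAnticyclotomic → ∀ (γ : Field.absoluteGaloisGroup K) [Fact (κ.IsTopGenerator γ)]
        (𝔭 : HeightOneSpectrum (𝓞 K)), ((p : ℕ) : 𝓞 K) ∈ 𝔭.asIdeal → 𝔭.asIdeal.ramificationIdx (𝓞 ℚ) = 1 →
        𝔭.asIdeal.inertiaDeg (𝓞 ℚ) = 1 → ∀ (𝔭' : HeightOneSpectrum (𝓞 K)), ((p : ℕ) : 𝓞 K) ∈ 𝔭'.asIdeal → 𝔭' ≠ 𝔭 →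
        ∀ (ι' : PadicAlgCl p ≃+* ℂ), SchneiderFree.BranchInducesPrime p ι' 𝔭 →
        ∀ (ΩK : ℂ) (Ωp : ℂ_[p]) (Q : PowerSeries (PadicComplexInt p)), ΩK ≠ 0 → Ωp ≠ 0 →
          R1.IsBDPLFunctionInt p ι' 𝔭 κ γ Dt.f ΩK Ωp Q →
          ∀ m < lambdaInvariant p (XAc (W.baseChange K) p κ 𝔭' ∅ γ),
            ‖((PowerSeries.coeff m Q : PadicComplexInt p) : ℂ_[p])‖ < 1 := by
  intro p _ W _ _ hCM hram h5 hr N _ K _ _ Dt hN hK hHN κ hκ γ _ 𝔭 h𝔭 he hf 𝔭' h𝔭' hne ι' hind ΩK Ωp Q hΩK hΩp hBDP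
  haveI hEK : (W.baseChange K).IsElliptic := inferInstanceAs (W.map (algebraMap ℚ K)).IsElliptic
  have hpr : p.Prime := Fact.out
  have hp2 : p ≠ 2 := by omega
  -- the residual line of the rational `p`-isogeny (LEAD g4), modulo CGLS Prop. 14
  obtain ⟨Φ, hfix, hΦ, hΨ⟩ := lineData_cmRamified_of_prop14 hfact p W hCM hram h5 N K hN hK hHN κ hκ 𝔭' h𝔭'
  -- (L) at the degree-one `𝔭'`: `W_K[p^∞]^{D_{𝔭'} ⊓ ker κ} = 0` from `W(ℚ_p)[p] = 0`
  have hadd : Addv W p := addv_of_cmRamified W hCM hram h5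
  have hpN : p ∣ N := by
    rw [← hN]; exact (W.dvd_conductorNorm_iff_not_hasGoodReductionAtPrime p).mpr hadd.1
  obtain ⟨he', hf'⟩ := degreeOne_of_dvd_of_heegner hK hHN hpN h𝔭'
  have hbot := SchneiderFreeAdditiveX3.fixedPoints_decomp_inf_kerSubgroup_eq_bot_of_noPTorsionPadic W p
    (prime_nsmul_eq_zero_padic_of_hasCM_of_cmRamified W p hCM h5 hram) κ 𝔭' h𝔭' he' hf'
  have hL : ∀ m : (W.baseChange K).geomPrimaryTorsion p,
      (∀ σ ∈ κ.kerSubgroup ⊓ decomp 𝔭', σ • m = m) → p • m = 0 → m = 0 := by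
    intro m hm _
    have hmem : m ∈ FixedPoints.addSubgroup ↥(decomp 𝔭' ⊓ κ.kerSubgroup) ((W.baseChange K).geomPrimaryTorsion p) :=
      (FixedPoints.mem_addSubgroup _ _ m).mpr fun d ↦ hm d (by
        obtain ⟨h1, h2⟩ := Subgroup.mem_inf.mp d.2
        exact Subgroup.mem_inf.mpr ⟨h2, h1⟩)
    rw [hbot] at hmem
    exact (AddSubgroup.mem_bot).mp hmem
  -- the congruence and the character bounds for this line
  obtain ⟨u, L₁, L₂, hu, hcong, hres⟩ :=
    hcb p W hCM hram h5 hr N K Dt hN hK hHN κ hκ γ 𝔭 h𝔭 he hf 𝔭' h𝔭' hne ι' hind ΩK Ωp Q hΩK hΩp hBDP Φ hfix hΦ hΨ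
  have h𝔭dec : ¬ (decomp 𝔭' ≤ κ.kerSubgroup) :=
    ZpExtension.not_decomp_le_kerSubgroup_of_isImaginaryQuadratic hK κ (by exact_mod_cast h𝔭')
  have hlam := pow_lambdaInvariant_empty_le_mul_natCard_residualSelmer_of_line (W.baseChange K) p κ 𝔭' γ hp2 h𝔭' h𝔭dec
    (fun v hv hpv ↦ by by_contra hbad; exact hv ⟨hbad, hpv⟩) Φ hfix hL hΦ hΨ
  have hle : ((lambdaInvariant p (XAc (W.baseChange K) p κ 𝔭' ∅ γ) : ℕ) : ℕ∞) ≤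
      (PowerSeries.map (residue (PadicComplexInt p)) L₁).order + (PowerSeries.map (residue (PadicComplexInt p)) L₂).order :=
    le_trans (by exact_mod_cast Nat.le_log_of_pow_le hpr.one_lt hlam) hres
  exact coeff_norm_lt_one_of_congr_of_le_order hu hcong hle

end Summit.BirchSwinnertonDyer.BirchSwinnertonDyer.Theorems.PrintCFram.LambdaResidualBound

end
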